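import Mathlib
import Summits.ResolutionOfSingularities.ResolutionOfSingularities.Theorems.WildQuotientsWildQuotientResolutionZ9PeeledRootChartAWeightZero
import Summits.ResolutionOfSingularities.ResolutionOfSingularities.Theorems.WildQuotientsWildQuotientResolutionToricExitRootChartPresentation
import Summits.ResolutionOfSingularities.ResolutionOfSingularities.Theorems.WildQuotientsWildQuotientResolutionJordanFiveChartW2RangeConversion

/-!
# The ℤ9 specimen, Z4a ring side (2/2): `(k[x][I₂₈ t])_{(x_a⁴ t)}` IS the `μ₇`-weight-`0` part; fixed points through the seam

(crux stmt-ResolutionOfSingularities-15640 `WildQuotients.WildQuotientResolution`, S1 = stmt-…-17941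
`CyclicQuotientFourfolds`; ℤ9 SPECIMEN of res-L1-w45c-idea-2's card P (`cardP_g12/Z9-SPECIMEN.md`,
piece `P₀ = D₊(x_a⁴ t)` of `V = Bl_{I₂₈} 𝔸ⁿ`), res-L1-w45c-plan-1 RE-POINT 2026-08-27T17:20:36Z
«stub-1: Z4a RING SIDE»; the ℤ9 twins of (A1) `JordanThreeTwo.exists_ringEquiv_chartRingA_weightZero`
(p547722) and (B) `JordanThreeTwo.chartA_seamFixed_iff`. [OURS · L1 W4.5c] — assembly of landed decls;
NOT a statement of any manuscript. Prover res-L1-w45c-stub-1. Def-free. Letters: `a b c` on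
`MvPolynomial (Fin n) k` (res-L1-w45c-plan-1 16:29:52Z), res-D-pv-033's `e24`/`(g, hg)`,
res-L1-w45c-stub-3's root substitution `ψ₀` and lift `ξ`.)

SETTING. `I₂₈ = span (range g)`, `g j = x_a^i x_b^j x_c^l` (`(i,j,l) = e24 j`), `g 0 = x_a⁴`; the vertex
chart ring `chartRing g 0 = (k[x][I₂₈ t])_{(x_a⁴ t)}` (Literature `BlowupChartRsop`), base map
`chartBase g 0 : F ↦ F/1`, generators `chartGen g 0 j = (g_j t)/(x_a⁴ t)`; the root substitution
`ψ₀ = aeval (x_a ↦ x_a⁷, x_b ↦ x_a⁴x_b, x_c ↦ x_ax_c)` (injective, `…Z9PeeledRootChartAWeightZero`).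

* `exists_ringEquiv_chartRingA_weightZero` — **(A1, ℤ9)**: for ANY subalgebra `E ⊆ k[x]` that is the
  weight-`0` part of a `μ₇`-weight `w` with `w(a,b,c) = (1,3,6)`, `0` on passengers, an isomorphism
  `eE : chartRing g 0 ≃+* E` with `eE (F/1) = ψ₀ F` and `eE ((g_j t)/(x_a⁴ t)) = q_j`
  (engine `ToricExit.nonempty_chartRing_ringEquiv_adjoin_of_rootData`, p489374, with `r = 1`, `N = 7`:
  `ψ₀ (x_a⁴) = (x_a⁴)⁷`; `adjoin = E` by `mem_adjoin_rootA_iff_isWeightedHomogeneous_zero`).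
* `chartA_fixed_iff_of_intertwines` / `chartA_seamFixed_iff` — **(B, ℤ9)**: for the graded family
  `φ` of the seam on `reesGrading I₂₈` (coefficient law `hφ`, powers clause `hP` at `s₀ = x_a⁴ t`) and the
  root lift `ξ` with `ψ₀ ∘ τ = ξ ∘ ψ₀` (res-L1-w45c-stub-3's `aeval_rootSubstA_comp`):
  `ξ (eE y) = eE y ↔ ∀ γ, HomogeneousLocalization.map (φ γ) _ y = y` (res-L1-w45c-lead-1's generic
  `BlowupExit.map_away_fixed_iff_of_intertwines`, degree `1`, `w = x_a⁴`, `τ x_a = x_a`). Hence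
  `Γ(P₀)^τ ≅ E^ξ` = the weight-`0` part of the K–L ring `k[x]^ξ` (`rootLiftA_fixedPoints_isRegularRing`)
  — the Bergh–Rydh chart datum of the piece `P₀` for Z5/Z6.
-/

-- single-problem summit: the doubled namespace component `ResolutionOfSingularities` is forced
set_option linter.dupNamespace false

noncomputable section

open MvPolynomial Polynomial HomogeneousLocalization Literature.AlgebraicGeometry.Resolution

namespace Summit.ResolutionOfSingularities.ResolutionOfSingularities.Theorems.WildQuotientResolution.Z9Peeled

variable (k : Type) [Field k] (n : ℕ) (a b c : Fin n)

/-- The exponent table of the 24 generators of `I₂₈` (res-D-pv-033's `e24`, verbatim). -/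
local notation3 "e24" => (![(4, 0, 0), (3, 2, 0), (3, 1, 3), (3, 0, 7), (2, 4, 0), (2, 3, 2), (2, 2, 6), (2, 1, 10), (2, 0, 14), (1, 6, 0), (1, 5, 1), (1, 4, 5), (1, 3, 9), (1, 2, 13), (1, 1, 17), (1, 0, 21), (0, 7, 0), (0, 6, 4), (0, 5, 8), (0, 4, 12), (0, 3, 16), (0, 2, 20), (0, 1, 24), (0, 0, 28)] : Fin 24 → ℕ × ℕ × ℕ)
/-- The root substitution `ψ₀` of the `x_a`-vertex chart (res-L1-w45c-stub-3's literal, verbatim). -/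
local notation3 "r₇" => (fun i : Fin n => if i = a then X a ^ 7 else if i = b then X a ^ 4 * X b
    else if i = c then X a * X c else (X i : MvPolynomial (Fin n) k))
/-- The ratio monomials `q_j = ψ₀(g_j) / ψ₀(x_a⁴)`. -/
local notation3 "q24" => (fun j : Fin 24 => (X a ^ (7 * (e24 j).1 + 4 * (e24 j).2.1 + (e24 j).2.2 - 28) *
    X b ^ (e24 j).2.1 * X c ^ (e24 j).2.2 : MvPolynomial (Fin n) k))

/-! ## (A1): the chart ring is the weight-`0` part -/

variable {a b c} in
set_option maxHeartbeats 800000 in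
/-- **(A1, ℤ9) `(k[x][I₂₈ t])_{(x_a⁴ t)} ≅ E`** for ANY subalgebra `E ⊆ k[x]` that is the weight-`0`
part of a `μ₇`-weight `w` with `w(a,b,c) = (1,3,6)`, `0` elsewhere: `eE : chartRing g 0 ≃+* E` with
`eE (F/1) = ψ₀ F` and `eE ((g_j t)/(x_a⁴ t)) = q_j`. [OURS · L1 W4.5c] [folklore; assembly of landed decls] -/
theorem exists_ringEquiv_chartRingA_weightZero (hab : a ≠ b) (hac : a ≠ c) (hbc : b ≠ c)
    (g : Fin 24 → MvPolynomial (Fin n) k)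
    (hg : ∀ q, g q = X a ^ (e24 q).1 * X b ^ (e24 q).2.1 * X c ^ (e24 q).2.2)
    (w : Fin n → ZMod 7) (hwa : w a = 1) (hwb : w b = 3) (hwc : w c = 6)
    (hw0 : ∀ i, i ≠ a → i ≠ b → i ≠ c → w i = 0)
    (E : Subalgebra k (MvPolynomial (Fin n) k)) (hE : ∀ f, f ∈ E ↔ IsWeightedHomogeneous w f 0) :
    ∃ eE : chartRing g 0 ≃+* ↥E,
      (∀ F : MvPolynomial (Fin n) k,
        ((eE (chartBase g 0 F) : ↥E) : MvPolynomial (Fin n) k) = aeval r₇ F) ∧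
      ∀ j : Fin 24, ((eE (chartGen g 0 j) : ↥E) : MvPolynomial (Fin n) k) = q24 j := by
  classical
  let ψ₀ : MvPolynomial (Fin n) k →ₐ[k] MvPolynomial (Fin n) k := aeval r₇
  have hinj : Function.Injective ψ₀ := aeval_rootA_injective k n hab hac hbc
  have hg0 : g 0 = X a ^ 4 := by rw [hg 0]; simp
  have hψa : ψ₀ (X a) = X a ^ 7 := rootA_X_a k n a b c
  have hunit : ψ₀ (g 0) * 1 = g 0 ^ 7 := by rw [hg0, map_pow, hψa, mul_one]; ring
  have hq : ∀ j : Fin 24, ψ₀ (g j) = q24 j * ψ₀ (g 0) := aeval_rootA_gens k n hab hac hbc g hg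
  set G : Set (MvPolynomial (Fin n) k) := Set.range (fun s : Fin n => ψ₀ (X s)) ∪ Set.range q24 with hG
  obtain ⟨e₀, hbase, hgen⟩ : ∃ e₀ : chartRing g 0 ≃+* ↥(Algebra.adjoin k G),
      (∀ f : MvPolynomial (Fin n) k,
        ((e₀ (chartBase g 0 f) : ↥(Algebra.adjoin k G)) : MvPolynomial (Fin n) k) = ψ₀ f) ∧
      ∀ j : Fin 24, ((e₀ (chartGen g 0 j) : ↥(Algebra.adjoin k G)) : MvPolynomial (Fin n) k) = q24 j :=
    ToricExit.nonempty_chartRing_ringEquiv_adjoin_of_rootData k g 0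
      (by rw [hg0]; exact pow_ne_zero _ (X_ne_zero a)) ψ₀ hinj 1 7 hunit q24 hq
  -- `adjoin k G = E`
  have hEq : Algebra.adjoin k G = E := by
    ext f
    rw [hE f]
    exact mem_adjoin_rootA_iff_isWeightedHomogeneous_zero k n hab hac hbc w hwa hwb hwc hw0 f
  refine ⟨e₀.trans (Subalgebra.equivOfEq _ _ hEq).toRingEquiv, fun F => ?_, fun j => ?_⟩
  · change ((Subalgebra.equivOfEq _ _ hEq (e₀ (chartBase g 0 F)) : ↥E) : MvPolynomial (Fin n) k) = _
    exact hbase F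
  · change ((Subalgebra.equivOfEq _ _ hEq (e₀ (chartGen g 0 j)) : ↥E) : MvPolynomial (Fin n) k) = _
    exact hgen j

/-! ## (B): fixed points through the seam -/

/-- **(B), ring-model form** on `B₀ = chartRing g 0`: for a graded family `φ` on `reesGrading I₂₈`
indexed by `⟨τ⟩` with the coefficient law `hφ` and the powers clause at `s₀ = x_a⁴ t`, ANY injective ring
model `e' : B₀ → U` with `e' (x_a⁴/1)` a non-zero-divisor and a ring map `Σ : U → U` with
`Σ (e' (F/1)) = e' ((τ F)/1)` (`τ x_a = x_a`): `(∀ γ, HomogeneousLocalization.map (φ γ) _ y = y) ↔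
Σ (e' y) = e' y`. [OURS · L1 W4.5c] [folklore; assembly of landed decls] -/
theorem chartA_fixed_iff_of_intertwines (g : Fin 24 → MvPolynomial (Fin n) k)
    (hg : ∀ q, g q = X a ^ (e24 q).1 * X b ^ (e24 q).2.1 * X c ^ (e24 q).2.2)
    (τ : MvPolynomial (Fin n) k ≃ₐ[k] MvPolynomial (Fin n) k) [Finite ↥(Subgroup.zpowers τ)]
    (hτa : τ (X a) = X a)
    (φ : ↥(Subgroup.zpowers τ) →
      (reesGrading (Ideal.span (Set.range g)) →+*ᵍ reesGrading (Ideal.span (Set.range g))))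
    (hφ : ∀ (γ : ↥(Subgroup.zpowers τ)) x,
      ((φ γ x : reesAlgebra (Ideal.span (Set.range g))) : (MvPolynomial (Fin n) k)[X]) =
        (x : (MvPolynomial (Fin n) k)[X]).map ((MulSemiringAction.toRingEquiv
          (↥(Subgroup.zpowers τ)) (MvPolynomial (Fin n) k) γ⁻¹ : _ ≃+* _) : _ →+* _))
    (hP : ∀ γ, Submonoid.powers (reesT (g 0) (Ideal.mem_span_range_self (f := g) (x := 0))) ≤
      (Submonoid.powers (reesT (g 0) (Ideal.mem_span_range_self (f := g) (x := 0)))).comap (φ γ))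
    {U : Type*} [CommRing U] (e' : chartRing g 0 →+* U) (he' : Function.Injective e')
    (hnzd : e' (chartBase g 0 (g 0)) ∈ nonZeroDivisors U)
    (Sg : U →+* U) (hSg : ∀ F, Sg (e' (chartBase g 0 F)) = e' (chartBase g 0 (τ F)))
    (y : chartRing g 0) :
    (∀ γ, HomogeneousLocalization.map (φ γ) (hP γ) y = y) ↔ Sg (e' y) = e' y := by
  have hg0 : g 0 = X a ^ 4 := by rw [hg 0]; simp
  have hτg0 : τ (g 0) = g 0 := by rw [hg0, map_pow, hτa]
  exact BlowupExit.map_away_fixed_iff_of_intertwines τ (reesT (g 0) (Ideal.mem_span_range_self))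
    (reesT_mem _ _) (g 0) (coe_reesT _ _) hτg0 φ hφ hP e' he' hnzd Sg hSg y

variable {a b c} in
/-- **(B) `chartA_seamFixed_iff`**: for `eE : chartRing g 0 ≃+* ↥E` onto a subalgebra `E ⊆ k[x]`
with `eE (F/1) = ψ₀ F` and the root lift `ξ` with `ψ₀ ∘ τ = ξ ∘ ψ₀` (`τ x_a = x_a`):
`ξ (eE y) = eE y ↔ ∀ γ, HomogeneousLocalization.map (φ γ) _ y = y` — the `⟨τ⟩`-fixed part of the chart
ring `Γ(P₀)` is carried by the seam onto `E^ξ`. [OURS · L1 W4.5c] [folklore; assembly of landed decls] -/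
theorem chartA_seamFixed_iff (g : Fin 24 → MvPolynomial (Fin n) k)
    (hg : ∀ q, g q = X a ^ (e24 q).1 * X b ^ (e24 q).2.1 * X c ^ (e24 q).2.2)
    (τ : MvPolynomial (Fin n) k ≃ₐ[k] MvPolynomial (Fin n) k) [Finite ↥(Subgroup.zpowers τ)]
    (hτa : τ (X a) = X a)
    (φ : ↥(Subgroup.zpowers τ) →
      (reesGrading (Ideal.span (Set.range g)) →+*ᵍ reesGrading (Ideal.span (Set.range g))))
    (hφ : ∀ (γ : ↥(Subgroup.zpowers τ)) x,
      ((φ γ x : reesAlgebra (Ideal.span (Set.range g))) : (MvPolynomial (Fin n) k)[X]) =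
        (x : (MvPolynomial (Fin n) k)[X]).map ((MulSemiringAction.toRingEquiv
          (↥(Subgroup.zpowers τ)) (MvPolynomial (Fin n) k) γ⁻¹ : _ ≃+* _) : _ →+* _))
    (hP : ∀ γ, Submonoid.powers (reesT (g 0) (Ideal.mem_span_range_self (f := g) (x := 0))) ≤
      (Submonoid.powers (reesT (g 0) (Ideal.mem_span_range_self (f := g) (x := 0)))).comap (φ γ))
    (E : Subalgebra k (MvPolynomial (Fin n) k)) (eE : chartRing g 0 ≃+* ↥E)
    (hbase : ∀ F, ((eE (chartBase g 0 F) : ↥E) : MvPolynomial (Fin n) k) = aeval r₇ F)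
    (ξ : MvPolynomial (Fin n) k ≃ₐ[k] MvPolynomial (Fin n) k)
    (hξ : ∀ F : MvPolynomial (Fin n) k, aeval r₇ (τ F) = ξ (aeval r₇ F))
    (y : chartRing g 0) :
    ξ ((eE y : ↥E) : MvPolynomial (Fin n) k) = ((eE y : ↥E) : MvPolynomial (Fin n) k) ↔
      ∀ γ, HomogeneousLocalization.map (φ γ) (hP γ) y = y := by
  have hg0 : g 0 = X a ^ 4 := by rw [hg 0]; simp
  let e' : chartRing g 0 →+* MvPolynomial (Fin n) k := E.val.toRingHom.comp eE.toRingHom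
  have he' : ∀ y, e' y = ((eE y : ↥E) : MvPolynomial (Fin n) k) := fun _ => rfl
  have hinj : Function.Injective e' := Subtype.val_injective.comp eE.injective
  have hnzd : e' (chartBase g 0 (g 0)) ∈ nonZeroDivisors (MvPolynomial (Fin n) k) := by
    refine mem_nonZeroDivisors_of_ne_zero ?_
    rw [he', hbase, hg0, map_pow, rootA_X_a k n a b c]
    exact pow_ne_zero _ (pow_ne_zero _ (X_ne_zero a))
  have h := chartA_fixed_iff_of_intertwines k n a b c g hg τ hτa φ hφ hP e' hinj hnzd
    (ξ : MvPolynomial (Fin n) k →+* MvPolynomial (Fin n) k)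
    (fun F => show ξ (e' (chartBase g 0 F)) = e' (chartBase g 0 (τ F)) by
      rw [he', he', hbase, hbase, hξ]) y
  rw [he'] at h
  exact h.symm

end Summit.ResolutionOfSingularities.ResolutionOfSingularities.Theorems.WildQuotientResolution.Z9Peeled

end
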